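import Summits.QuantumFields.YangMills.Theorems.F4SubCurvatureDoorSubCurvatureKernelDensity
import Summits.QuantumFields.YangMills.Theorems.F4SubCurvatureDoorSubCurvatureKernelFibreAveraging
import HarnessLib

/-!
# Route `F4SubCurvatureDoor`, crux `SubCurvatureKernel` ⟨stmt-QuantumFields-23036⟩ — KERNEL EXTRACTION at separation `δ`
# (clause (K) of the soft half, kernel-generic)

Helper file (`--supports stmt-QuantumFields-23036 --as helper`; free-hands seat `ym-line-frs-p2` g17, clause (K) of the soft-half scope, HOME INBOX
2026-08-29T16:34:27Z / 16:47:40Z).  Definition-free, KERNEL-GENERIC (no lattice input), 0 sorry, standard axioms.  No item is closed; no summit,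
no crux and no mass gap is proved by this file.

WHAT.  `exists_kernel_of_translate_invariant`: a continuous linear functional `S₂` on `𝓢((ℝ⁴)², ℂ)` which (i) obeys the density bound of an
off-diagonal limit point at separation `δ` (`‖S₂ F‖ ≤ B ∫ ‖F‖` for compactly supported `F` supported in `Separated 2 δ`) and (ii) is TRANSLATION
INVARIANT on off-diagonal test functions (`S₂ (F(· − t, · − t)) = S₂ F`) is, on compactly supported test functions supported in `Separated 2 (3δ)`,
integration against a KERNEL OF THE DIFFERENCE VARIABLE: `S₂ F = ∫ K(x₀ − x₁) F(x) dx` with `K : ℝ⁴ → ℂ` measurable and `‖K‖ ≤ 2B`.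
Assembly of ✓`exists_twoPointDensity` (sibling file; cutoff + weight + ✓`exists_extend_L1` + LEAD's ✓`exists_bounded_density_of_l1_bounded`),
the a.e. diagonal-translation invariance of that density (this file: uniqueness of densities on the open set `{2δ < ‖x₀ − x₁‖}`, Mathlib
`IsOpen.ae_eq_zero_of_integral_contDiff_smul_eq_zero`, translation invariance of Lebesgue measure) and ✓`exists_kernel_of_diag_translate_invariant_on`
(sibling file, fibre averaging).

HONEST LABEL: clause (K) of the SOFT half of ⟨23036⟩ for test functions supported AWAY from the diagonal (scale `3δ`, any `δ > 0`); the extension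
to all off-diagonal compactly supported test functions needs the quantitative `δ⁻⁸` growth of the density constant; (C) continuity and the SUB-CURVATURE
clause (asymptotic freedom) remain OPEN; ⟨23036⟩ is an open problem; the Yang–Mills mass gap is NOT proved; no summit is proved by a line.
-/

set_option autoImplicit false

noncomputable section

open scoped SchwartzMap BigOperators ContDiff
open MeasureTheory Filter Topology Set
open Literature.MathematicalPhysics.QuantumLattice (translateMulti translateMulti_apply)
open Literature.MathematicalPhysics.AQFT (IsOffDiagonal coincidenceLocus mem_coincidenceLocus)
open Summit.QuantumFields.YangMills.Cruxes.OSLegsAtWeakCouplingC.Sketch (Separated)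
open Summit.QuantumFields.YangMills.Theorems.F4SubCurvatureDoorSubCurvatureKernelDensity
  (exists_twoPointDensity mem_separated_of_le le_norm_sub_of_mem_separated)
open Summit.QuantumFields.YangMills.Theorems.F4SubCurvatureDoorSubCurvatureKernelFibre (exists_kernel_of_diag_translate_invariant_on)

namespace Summit.QuantumFields.YangMills.Theorems.F4SubCurvatureDoorSubCurvatureKernelExtraction

/-- A smooth compactly supported real function supported at `2δ < ‖x₀ − x₁‖`, complexified, is an off-diagonal compactly supported Schwartz test
function supported in `Separated 2 (2δ)`. [bookkeeping] -/
theorem test_props {δ : ℝ} (hδ : 0 < δ) (g : (Fin 2 → EuclideanSpace ℝ (Fin 4)) → ℝ) (hgs : ContDiff ℝ ∞ g)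
    (hgc : HasCompactSupport g) (hgU : tsupport g ⊆ {x | 2 * δ < ‖x 0 - x 1‖}) :
    ∃ (hc : HasCompactSupport fun x => ((g x : ℝ) : ℂ)) (hs : ContDiff ℝ ∞ fun x => ((g x : ℝ) : ℂ)),
      tsupport (fun x => ((g x : ℝ) : ℂ)) ⊆ Separated 2 (2 * δ) ∧ IsOffDiagonal (hc.toSchwartzMap hs) := by
  have hc : HasCompactSupport fun x => ((g x : ℝ) : ℂ) := hgc.comp_left Complex.ofReal_zero
  have hs : ContDiff ℝ ∞ fun x => ((g x : ℝ) : ℂ) := Complex.ofRealCLM.contDiff.comp hgs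
  have hsupp : tsupport (fun x => ((g x : ℝ) : ℂ)) ⊆ {x | 2 * δ < ‖x 0 - x 1‖} :=
    (tsupport_comp_subset Complex.ofReal_zero _).trans hgU
  refine ⟨hc, hs, fun x hx => mem_separated_of_le (le_of_lt (hsupp hx)), ?_⟩
  refine IsOffDiagonal.of_tsupport_subset fun x hx hco => ?_
  obtain ⟨i, j, hij, hyij⟩ := (mem_coincidenceLocus x).1 hco
  have hlt : 2 * δ < ‖x 0 - x 1‖ := hsupp hx
  have h01 : x 0 = x 1 := by
    fin_cases i <;> fin_cases j
    · exact absurd rfl hij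
    · exact hyij
    · exact hyij.symm
    · exact absurd rfl hij
  rw [h01, sub_self, norm_zero] at hlt
  linarith

/-- Diagonal translates of a compactly supported test function supported in `Separated 2 δ` are again compactly supported and supported in
`Separated 2 δ` (pairwise distances are translation invariant). [bookkeeping] -/
theorem translate_props {δ : ℝ} (F : 𝓢((Fin 2 → EuclideanSpace ℝ (Fin 4)), ℂ)) (hFc : HasCompactSupport (F : _ → ℂ))
    (hFs : tsupport (F : _ → ℂ) ⊆ Separated 2 δ) (t : EuclideanSpace ℝ (Fin 4)) :
    HasCompactSupport (translateMulti t F : _ → ℂ) ∧ tsupport (translateMulti t F : _ → ℂ) ⊆ Separated 2 δ := by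
  set τ : (Fin 2 → EuclideanSpace ℝ (Fin 4)) ≃ₜ (Fin 2 → EuclideanSpace ℝ (Fin 4)) := Homeomorph.addRight (-fun _ => t) with hτ
  have hτ_apply : ∀ x, τ x = fun i => x i - t := fun x => by
    funext i; simp [hτ, sub_eq_add_neg]
  have hcomp : ((translateMulti t F : 𝓢((Fin 2 → EuclideanSpace ℝ (Fin 4)), ℂ)) : _ → ℂ) = (F : _ → ℂ) ∘ τ := by
    funext x; rw [Function.comp_apply, translateMulti_apply, hτ_apply]
  refine ⟨by rw [hcomp]; exact hFc.comp_homeomorph τ, fun x hx => ?_⟩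
  rw [hcomp, tsupport, Function.support_comp_eq_preimage, ← τ.preimage_closure] at hx
  have hx' : (fun i => x i - t) ∈ Separated 2 δ := by
    have h : τ x ∈ tsupport (F : _ → ℂ) := hx
    rw [hτ_apply] at h
    exact hFs h
  intro i j hij
  have h := hx' i j hij
  simpa [dist_eq_norm] using h

/-- ★ **KERNEL EXTRACTION at separation `δ`.**  A continuous linear functional on `𝓢((ℝ⁴)², ℂ)` with the density bound at separation `δ` and
translation invariance on off-diagonal test functions is integration against a bounded measurable kernel of the difference variable on compactly
supported test functions supported in `Separated 2 (3δ)`. [cite: Rudin1987, Thm. 6.16] [folklore] -/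
theorem exists_kernel_of_translate_invariant (S₂ : 𝓢((Fin 2 → EuclideanSpace ℝ (Fin 4)), ℂ) →L[ℂ] ℂ) {δ B : ℝ} (hδ : 0 < δ)
    (hB : 0 ≤ B)
    (hdens : ∀ F : 𝓢((Fin 2 → EuclideanSpace ℝ (Fin 4)), ℂ), HasCompactSupport (F : _ → ℂ) →
      tsupport (F : _ → ℂ) ⊆ Separated 2 δ → ‖S₂ F‖ ≤ B * ∫ x, ‖F x‖)
    (htrans : ∀ (t : EuclideanSpace ℝ (Fin 4)) (F : 𝓢((Fin 2 → EuclideanSpace ℝ (Fin 4)), ℂ)), IsOffDiagonal F →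
      S₂ (translateMulti t F) = S₂ F) :
    ∃ K : EuclideanSpace ℝ (Fin 4) → ℂ, Measurable K ∧ (∀ u, ‖K u‖ ≤ 2 * B) ∧
      ∀ F : 𝓢((Fin 2 → EuclideanSpace ℝ (Fin 4)), ℂ), HasCompactSupport (F : _ → ℂ) →
        tsupport (F : _ → ℂ) ⊆ Separated 2 (3 * δ) →
          Integrable (fun x => K (x 0 - x 1) * F x) ∧ S₂ F = ∫ x, K (x 0 - x 1) * F x := by
  obtain ⟨W, hWm, hWb, hWrep⟩ := exists_twoPointDensity S₂ hδ hB hdens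
  have hB2 : 0 ≤ 2 * B := by positivity
  -- the open region `U = {2δ < ‖x₀ − x₁‖}`
  set U : Set (Fin 2 → EuclideanSpace ℝ (Fin 4)) := {x | 2 * δ < ‖x 0 - x 1‖} with hU
  have hUo : IsOpen U := isOpen_lt continuous_const ((continuous_apply 0).sub (continuous_apply 1)).norm
  -- diagonal-translation invariance of the density, a.e. on `U`
  have hinv : ∀ t : EuclideanSpace ℝ (Fin 4), ∀ᵐ x : Fin 2 → EuclideanSpace ℝ (Fin 4),
      x 0 - x 1 ∈ {u : EuclideanSpace ℝ (Fin 4) | 2 * δ < ‖u‖} → W (x + fun _ => t) = W x := by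
    intro t
    set D : (Fin 2 → EuclideanSpace ℝ (Fin 4)) → ℂ := fun x => W (x + fun _ => t) - W x with hD
    have hDm : Measurable D := (hWm.comp (measurable_id.add measurable_const)).sub hWm
    have hDb : ∀ x, ‖D x‖ ≤ ‖((2 * B + 2 * B : ℝ) : ℂ)‖ := fun x => by
      rw [Complex.norm_real, Real.norm_eq_abs, abs_of_nonneg (by positivity)]
      exact (norm_sub_le _ _).trans (add_le_add (hWb _) (hWb _))
    have hDli : LocallyIntegrableOn D U volume :=
      ((locallyIntegrable_const ((2 * B + 2 * B : ℝ) : ℂ)).mono hDm.aestronglyMeasurable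
        (Eventually.of_forall hDb)).locallyIntegrableOn U
    have hmain : ∀ g : (Fin 2 → EuclideanSpace ℝ (Fin 4)) → ℝ, ContDiff ℝ ∞ g → HasCompactSupport g → tsupport g ⊆ U →
        ∫ x, g x • D x = 0 := by
      intro g hgs hgc hgU
      obtain ⟨hc, hs, hsep, hoff⟩ := test_props hδ g hgs hgc hgU
      set G : 𝓢((Fin 2 → EuclideanSpace ℝ (Fin 4)), ℂ) := hc.toSchwartzMap hs with hG
      have hGf : ∀ x, G x = ((g x : ℝ) : ℂ) := fun x => rfl
      obtain ⟨hGtc, hGts⟩ := translate_props G hc hsep t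
      -- both `G` and its translate are represented by `W`
      obtain ⟨hI0, h0⟩ := hWrep G hc hsep
      obtain ⟨hIt, ht⟩ := hWrep (translateMulti t G) hGtc hGts
      have hS : S₂ (translateMulti t G) = S₂ G := htrans t G hoff
      -- change of variables in the translated integral
      have hcv : ∫ x, W x * (translateMulti t G) x = ∫ y, W (y + fun _ => t) * G y := by
        have h := integral_add_right_eq_self (μ := (volume : Measure (Fin 2 → EuclideanSpace ℝ (Fin 4))))
          (fun x => W x * (translateMulti t G) x) (fun _ => t)
        rw [← h]
        refine integral_congr_ae (Eventually.of_forall fun y => ?_)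
        simp only [translateMulti_apply]
        congr 2
        funext i
        simp
      have hIt' : Integrable fun y => W (y + fun _ => t) * G y := by
        have h := hIt.comp_add_right (fun _ => t)
        refine h.congr (Eventually.of_forall fun y => ?_)
        simp only [translateMulti_apply]
        congr 2
        funext i
        simp
      have hzero : ∫ y, D y * G y = 0 := by
        have h1 : ∫ y, D y * G y = (∫ y, W (y + fun _ => t) * G y) - ∫ y, W y * G y := by
          rw [← integral_sub hIt' hI0]
          refine integral_congr_ae (Eventually.of_forall fun y => ?_)
          simp only [hD]; ring
        rw [h1, ← hcv, ← ht, ← h0, hS, sub_self]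
      rw [← hzero]
      refine integral_congr_ae (Eventually.of_forall fun x => ?_)
      beta_reduce
      rw [hGf, Complex.real_smul, mul_comm]
    have hae := hUo.ae_eq_zero_of_integral_contDiff_smul_eq_zero hDli hmain
    refine hae.mono fun x hx hxU => ?_
    have h := hx hxU
    simp only [hD, sub_eq_zero] at h
    exact h
  -- fibre averaging
  have hVm : MeasurableSet {u : EuclideanSpace ℝ (Fin 4) | 2 * δ < ‖u‖} := (isOpen_lt continuous_const continuous_norm).measurableSet
  obtain ⟨K, hKm, hKb, hKae⟩ := exists_kernel_of_diag_translate_invariant_on _ hVm W hWm hWb hinv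
  refine ⟨K, hKm, hKb, fun F hFc hFs => ?_⟩
  have hFs2 : tsupport (F : _ → ℂ) ⊆ Separated 2 (2 * δ) := fun x hx i j hij =>
    le_trans (by linarith) (hFs hx i j hij)
  obtain ⟨hWFi, hWF⟩ := hWrep F hFc hFs2
  have hFi : Integrable (fun x => F x) := F.continuous.integrable_of_hasCompactSupport hFc
  have hKFi : Integrable (fun x : Fin 2 → EuclideanSpace ℝ (Fin 4) => K (x 0 - x 1) * F x) :=
    hFi.bdd_mul (hKm.comp ((measurable_pi_apply 0).sub (measurable_pi_apply 1))).aestronglyMeasurable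
      (Eventually.of_forall fun x => hKb _)
  refine ⟨hKFi, ?_⟩
  rw [hWF]
  refine integral_congr_ae (hKae.mono fun x hx => ?_)
  by_cases hFx : F x = 0
  · simp [hFx]
  · have hxV : x 0 - x 1 ∈ {u : EuclideanSpace ℝ (Fin 4) | 2 * δ < ‖u‖} := by
      have h3 : 3 * δ ≤ ‖x 0 - x 1‖ := le_norm_sub_of_mem_separated (hFs (subset_tsupport _ hFx))
      show 2 * δ < ‖x 0 - x 1‖
      linarith
    beta_reduce
    rw [hx hxV]

end Summit.QuantumFields.YangMills.Theorems.F4SubCurvatureDoorSubCurvatureKernelExtraction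

end
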